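/-
Copyright (c) 2026. All rights reserved.
Released under Apache 2.0 license as described in the file LICENSE.
Authors: abc-iut cell, seat abc-iut-w5-d115 (gen 7).
-/
import Literature.GroupTheory.StronglyCompleteOperatorSerre
import Literature.GroupTheory.ProPPowerMap
import Literature.GroupTheory.ProPStronglyComplete

/-!
# Strong completeness of a profinite group modulo a normally finitely generated pro-`p` subgroup

Sequel of `StronglyCompleteOperatorSerre.lean` (same seat): the descent there
(`isOpen_of_proP_normallyGenerated_of_sup_eq_top`, normal `H` with `H P = G` and `G ⧸ H` a
`p`-group) is promoted to ALL finite-index subgroups.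

THEOREM (`isOpen_of_finiteIndex_of_proP_normallyGenerated`).  Let `G` be a profinite group which is
topologically finitely generated, `P ⊴ G` a CLOSED normal PRO-`p` subgroup which is the topological
normal closure of finitely many elements, and assume (a): every finite-index subgroup `K ≥ P` is
open (strong completeness of `G ⧸ P`).  Then EVERY finite-index subgroup of `G` is open.

For `P = G` this is Serre's theorem (tree: `ProPStronglyComplete.lean`); the point is that `P` need
not be topologically finitely generated.  For `G = Gal(k̄/k)`, `k` a `p`-adic field, and `P` the
wild inertia group, (a) is the strong completeness of the tame quotient and the normal finite
generation of `P` is elementary (abc-iut-w6-d103, `ProP/NormalGeneratorsProfinite.lean`); the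
theorem then gives the instance of the Nikolov–Segal theorem the abc-iut cell consumes (FACT F-1977
at `G_k`, GAP G-L3d2g2-1) without Nikolov–Segal.

PROOF.  Pass to the normal core `H`; `G₁ = H P ⊇ P` is open by (a).  Inside the profinite group
`G₁` (topologically finitely generated by Schreier, `exists_finset_dense_closure_of_isOpen`; `P` is
topologically normally generated in `G₁` by the conjugates of the generators under a transversal of
`G ⧸ G₁`; (a) persists), `G₁ ⧸ H ≅ P ⧸ (P ∩ H)` is an abstract finite quotient of the pro-`p` group
`P`, hence a `p`-group (`isPGroup_quotient_of_finiteIndex_of_proP`), and the descent applies.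

HONEST FRAMING: elementary profinite group theory; nothing here bears on [IUTchIII] Cor. 3.12 or
asserts anything about abc.

## References
* J.-P. Serre, *Galois Cohomology*, I §4.2, exercise 6. [SerreGaloisCohomology1997]
* J. D. Dixon, M. du Sautoy, A. Mann, D. Segal, *Analytic pro-`p` groups*, 2nd ed., Ch. 1,
  Thm. 1.17. [DixonDuSautoyMannSegal1999]
* L. Ribes, P. Zalesskii, *Profinite Groups*, 2nd ed., §4.2. [RibesZalesskii2010]
-/

namespace Literature.GroupTheory

open Subgroup Topology
open scoped commutatorElement Pointwise

universe u

variable {G : Type u} [Group G] [TopologicalSpace G] [IsTopologicalGroup G] [CompactSpace G]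
  [TotallyDisconnectedSpace G]

/-- Pro-`p` in the element form ("`x ^ p ^ a → 1`") for a closed subgroup `P` implies pro-`p` in the
quotient form for the profinite group `P` itself: `P ⧸ U` is a `p`-group for every open normal
subgroup `U` of `P` (an open subgroup of the subspace `P` contains `W ∩ P` for an open normal
subgroup `W` of `G`). [cite: DixonDuSautoyMannSegal1999, §1.2] -/
theorem isPGroup_quotient_of_forall_pow_mem {p : ℕ} {P : Subgroup G}
    (hP : ∀ x ∈ P, ∀ U : Subgroup G, IsOpen (U : Set G) → ∃ a : ℕ, x ^ (p ^ a) ∈ U)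
    (U : OpenNormalSubgroup P) : IsPGroup p (P ⧸ (U : Subgroup P)) := by
  intro z
  obtain ⟨x, rfl⟩ := QuotientGroup.mk_surjective z
  obtain ⟨V, hV, hVU⟩ := isOpen_induced_iff.mp U.isOpen
  have h1V : (1 : G) ∈ V := by
    have h1 : (1 : P) ∈ ((Subtype.val : P → G) ⁻¹' V) := by
      rw [hVU]; exact one_mem (U : Subgroup P)
    exact h1
  obtain ⟨W, hW⟩ := ProfiniteGrp.exist_openNormalSubgroup_sub_open_nhds_of_one hV h1V
  obtain ⟨a, ha⟩ := hP x x.2 W W.isOpen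
  refine ⟨a, ?_⟩
  rw [← QuotientGroup.mk_pow, QuotientGroup.eq_one_iff]
  have hmem : (x ^ p ^ a : P) ∈ ((Subtype.val : P → G) ⁻¹' V) := hW ha
  rw [hVU] at hmem
  exact hmem

/-- **Strong completeness modulo a normally finitely generated pro-`p` subgroup.**  `G` profinite,
topologically generated by `g₁, …, g_d`; `P ⊴ G` closed, pro-`p` (every `x ∈ P` has
`x ^ p ^ a ∈ U` for each open subgroup `U`), equal to the topological normal closure of
`y₁, …, y_n ∈ P`; (a) every finite-index subgroup containing `P` is open.  Then every finite-index
subgroup of `G` is open.  (Serre's theorem is the case `P = G`; for `G = G_k`, `P` the wild inertia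
this is the abc-iut FACT F-1977 instance, modulo the elementary inputs (a) for the tame quotient and
the normal finite generation of `P`.)
[cite: DixonDuSautoyMannSegal1999, Ch. 1 Thm. 1.17] [cite: SerreGaloisCohomology1997, I §4.2 ex. 6] -/
theorem isOpen_of_finiteIndex_of_proP_normallyGenerated {p : ℕ} [hp : Fact p.Prime]
    {P : Subgroup G} [hPn : P.Normal] (hPc : IsClosed (P : Set G))
    (hP : ∀ x ∈ P, ∀ U : Subgroup G, IsOpen (U : Set G) → ∃ a : ℕ, x ^ (p ^ a) ∈ U)
    {d : ℕ} {g : Fin d → G} (hg : (Subgroup.closure (Set.range g)).topologicalClosure = ⊤)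
    {n : ℕ} {y : Fin n → G} (hy : ∀ a, y a ∈ P)
    (hyP : (Subgroup.normalClosure (Set.range y)).topologicalClosure = P)
    (ha : ∀ K : Subgroup G, P ≤ K → K.FiniteIndex → IsOpen (K : Set G))
    (H₀ : Subgroup G) [H₀.FiniteIndex] : IsOpen (H₀ : Set G) := by
  classical
  -- pass to the normal core `H` and to the open subgroup `G₁ = H ⊔ P`
  set H : Subgroup G := H₀.normalCore with hH
  refine Subgroup.isOpen_mono (Subgroup.normalCore_le H₀) ?_
  set G₁ : Subgroup G := H ⊔ P with hG₁
  have hPG₁ : P ≤ G₁ := le_sup_right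
  have hHG₁ : H ≤ G₁ := le_sup_left
  haveI : G₁.FiniteIndex := Subgroup.finiteIndex_of_le hHG₁
  have hG₁o : IsOpen (G₁ : Set G) := ha G₁ hPG₁ inferInstance
  have hG₁c : IsClosed (G₁ : Set G) := Subgroup.isClosed_of_isOpen G₁ hG₁o
  haveI : CompactSpace G₁ := isCompact_iff_compactSpace.mp hG₁c.isCompact
  -- the players inside `G₁`
  set P₁ : Subgroup G₁ := P.subgroupOf G₁ with hP₁
  set H₁ : Subgroup G₁ := H.subgroupOf G₁ with hH₁
  haveI hP₁n : P₁.Normal := hPn.subgroupOf G₁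
  haveI hH₁n : H₁.Normal := (Subgroup.normalCore_normal H₀).subgroupOf G₁
  have hP₁c : IsClosed (P₁ : Set G₁) := hPc.preimage continuous_subtype_val
  -- pro-`p`, element form, inside `G₁`
  have hP₁el : ∀ x ∈ P₁, ∀ U : Subgroup G₁, IsOpen (U : Set G₁) → ∃ a : ℕ, x ^ (p ^ a) ∈ U := by
    intro x hx U hU
    have hUo : IsOpen ((U.map G₁.subtype : Subgroup G) : Set G) := by
      have : ((U.map G₁.subtype : Subgroup G) : Set G) = Subtype.val '' (U : Set G₁) := by
        ext z; simp only [Subgroup.coe_map, Subgroup.coe_subtype]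
      rw [this]
      exact hG₁o.isOpenMap_subtype_val _ hU
    obtain ⟨a, ha⟩ := hP (x : G) (Subgroup.mem_subgroupOf.mp hx) _ hUo
    refine ⟨a, ?_⟩
    obtain ⟨u, hu, hux⟩ := Subgroup.mem_map.mp ha
    have : u = x ^ p ^ a := Subtype.ext (by rw [Subgroup.coe_subtype] at hux; rw [hux, Subgroup.coe_pow])
    exact this ▸ hu
  -- `G₁` is topologically finitely generated (Schreier)
  have hfgG : ∃ S : Finset G, Dense ((Subgroup.closure (S : Set G) : Subgroup G) : Set G) := by
    refine ⟨Finset.univ.image g, ?_⟩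
    have : ((Finset.univ.image g : Finset G) : Set G) = Set.range g := by
      ext z; simp only [Finset.coe_image, Finset.coe_univ, Set.image_univ]
    rw [this, dense_iff_closure_eq, ← Subgroup.topologicalClosure_coe, hg, Subgroup.coe_top]
  obtain ⟨S₁, hS₁⟩ := exists_finset_dense_closure_of_isOpen hfgG G₁ hG₁o
  set d₁ := S₁.card with hd₁
  set g₁ : Fin d₁ → G₁ := fun i => (S₁.equivFin.symm i : G₁) with hg₁def
  have hrange : Set.range g₁ = (S₁ : Set G₁) := by
    ext z
    constructor
    · rintro ⟨i, rfl⟩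
      exact (S₁.equivFin.symm i).2
    · intro hz
      exact ⟨S₁.equivFin ⟨z, hz⟩, by simp [hg₁def]⟩
  have hg₁ : (Subgroup.closure (Set.range g₁)).topologicalClosure = ⊤ := by
    rw [hrange]
    exact SetLike.coe_injective (by
      rw [Subgroup.topologicalClosure_coe, Subgroup.coe_top]; exact hS₁.closure_eq)
  -- `P₁` is topologically normally finitely generated in `G₁`: conjugates under a transversal
  haveI : Finite (G ⧸ G₁) := Subgroup.quotient_finite_of_isOpen G₁ hG₁o
  have hconj : ∀ (q : G ⧸ G₁) (a : Fin n), (q.out⁻¹ * y a * q.out : G) ∈ G₁ := fun q a =>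
    hPG₁ (by simpa only [inv_inv] using hPn.conj_mem (y a) (hy a) q.out⁻¹)
  set y₁ : (G ⧸ G₁) × Fin n → G₁ := fun qa => ⟨(qa.1.out⁻¹ * y qa.2 * qa.1.out : G), hconj qa.1 qa.2⟩
    with hy₁def
  have hy₁P : ∀ qa, y₁ qa ∈ P₁ := fun qa => by
    rw [hP₁, Subgroup.mem_subgroupOf]
    simpa only [inv_inv] using hPn.conj_mem (y qa.2) (hy qa.2) qa.1.out⁻¹
  -- the topological normal closure of the `y₁` (in `G₁`) is `P₁`
  set N₁ : Subgroup G₁ := (Subgroup.normalClosure (Set.range y₁)).topologicalClosure with hN₁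
  have hN₁le : N₁ ≤ P₁ :=
    Subgroup.topologicalClosure_minimal _
      (Subgroup.normalClosure_le_normal (by rintro _ ⟨qa, rfl⟩; exact hy₁P qa)) hP₁c
  have hP₁le : P₁ ≤ N₁ := by
    intro x hx
    rw [hP₁, Subgroup.mem_subgroupOf, ← hyP] at hx
    -- `(x : G)` lies in the closure of `ncl_G(y)`, which is contained in the image of `ncl_{G₁}(y₁)`
    have hsub : ((Subgroup.normalClosure (Set.range y) : Subgroup G) : Set G) ⊆
        Subtype.val '' ((Subgroup.normalClosure (Set.range y₁) : Subgroup G₁) : Set G₁) := by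
      have hle : Subgroup.normalClosure (Set.range y) ≤
          (Subgroup.normalClosure (Set.range y₁)).map G₁.subtype := by
        unfold Subgroup.normalClosure
        rw [Subgroup.closure_le]
        intro z hz
        rw [Group.mem_conjugatesOfSet_iff] at hz
        obtain ⟨_, ⟨a, rfl⟩, hconjz⟩ := hz
        obtain ⟨c, rfl⟩ := isConj_iff.mp hconjz
        -- `c = h t⁻¹` with `t = (c⁻¹ G₁).out`, `h ∈ G₁`
        obtain ⟨⟨h, hh⟩, hout⟩ := QuotientGroup.mk_out_eq_mul G₁ c⁻¹
        set t : G := (QuotientGroup.mk c⁻¹ : G ⧸ G₁).out with ht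
        have hc : c = h * t⁻¹ := by
          have : t = c⁻¹ * h := hout
          rw [this, mul_inv_rev, inv_inv, mul_inv_cancel_left]
        have hmem : (⟨h, hh⟩ * y₁ (QuotientGroup.mk c⁻¹, a) * ⟨h, hh⟩⁻¹ : G₁) ∈
            Subgroup.closure (Group.conjugatesOfSet (Set.range y₁)) :=
          (Subgroup.normalClosure_normal (s := Set.range y₁)).conj_mem _
            (Subgroup.subset_normalClosure ⟨(QuotientGroup.mk c⁻¹, a), rfl⟩) _
        refine ⟨_, hmem, ?_⟩
        simp only [Subgroup.coe_subtype, Subgroup.coe_mul, Subgroup.coe_inv, hy₁def]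
        rw [← ht, hc]
        group
      intro z hz
      obtain ⟨w, hw, rfl⟩ := Subgroup.mem_map.mp (hle hz)
      exact ⟨w, hw, rfl⟩
    have hxc : (x : G) ∈ _root_.closure
        (Subtype.val '' ((Subgroup.normalClosure (Set.range y₁) : Subgroup G₁) : Set G₁)) := by
      have : (x : G) ∈ _root_.closure
          ((Subgroup.normalClosure (Set.range y) : Subgroup G) : Set G) := by
        rw [← Subgroup.topologicalClosure_coe]; exact hx
      exact closure_mono hsub this
    rw [hN₁]
    show x ∈ ((Subgroup.normalClosure (Set.range y₁)).topologicalClosure : Set G₁)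
    rw [Subgroup.topologicalClosure_coe, IsInducing.subtypeVal.closure_eq_preimage_closure_image]
    exact hxc
  have hy₁N : (Subgroup.normalClosure (Set.range y₁)).topologicalClosure = P₁ :=
    le_antisymm hN₁le hP₁le
  -- (a) inside `G₁`
  have ha₁ : ∀ K : Subgroup G₁, P₁ ≤ K → K.FiniteIndex → IsOpen (K : Set G₁) := by
    intro K hPK hK
    have hPK' : P ≤ K.map G₁.subtype := by
      intro z hz
      exact ⟨⟨z, hPG₁ hz⟩, hPK (Subgroup.mem_subgroupOf.mpr hz), rfl⟩
    haveI : (K.map G₁.subtype).FiniteIndex := by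
      refine ⟨?_⟩
      rw [Subgroup.index_map_subtype]
      exact mul_ne_zero hK.index_ne_zero Subgroup.FiniteIndex.index_ne_zero
    have hKo : IsOpen ((K.map G₁.subtype : Subgroup G) : Set G) := ha _ hPK' inferInstance
    have : (K : Set G₁) = Subtype.val ⁻¹' ((K.map G₁.subtype : Subgroup G) : Set G) := by
      ext z
      simp only [SetLike.mem_coe, Set.mem_preimage, Subgroup.mem_map, Subgroup.coe_subtype]
      constructor
      · intro hz; exact ⟨z, hz, rfl⟩
      · rintro ⟨w, hw, hwz⟩; exact (Subtype.ext hwz) ▸ hw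
    rw [this]
    exact hKo.preimage continuous_subtype_val
  -- `H₁ ⊔ P₁ = ⊤` and `G₁ ⧸ H₁` is a `p`-group
  haveI : H₁.FiniteIndex := inferInstance
  have hsup : H₁ ⊔ P₁ = ⊤ := by
    rw [eq_top_iff]
    rintro ⟨x, hx⟩ -
    have hx' : (x : G) ∈ ((H ⊔ P : Subgroup G) : Set G) := hx
    rw [Subgroup.mul_normal] at hx'
    obtain ⟨h, hh, q, hq, rfl⟩ := Set.mem_mul.mp hx'
    have hhG : h ∈ G₁ := hHG₁ hh
    have hqG : q ∈ G₁ := hPG₁ hq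
    have : (⟨h * q, hx⟩ : G₁) = ⟨h, hhG⟩ * ⟨q, hqG⟩ := rfl
    rw [this]
    exact mul_mem (Subgroup.mem_sup_left (Subgroup.mem_subgroupOf.mpr hh))
      (Subgroup.mem_sup_right (Subgroup.mem_subgroupOf.mpr hq))
  haveI : CompactSpace P := isCompact_iff_compactSpace.mp hPc.isCompact
  have hPq : ∀ q ∈ P, ∃ k : ℕ, q ^ (p ^ k) ∈ H := by
    intro q hq
    haveI : (H.subgroupOf P).Normal := (Subgroup.normalCore_normal H₀).subgroupOf P
    have hpg : IsPGroup p (P ⧸ H.subgroupOf P) :=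
      isPGroup_quotient_of_finiteIndex_of_proP (isPGroup_quotient_of_forall_pow_mem hP) _
    obtain ⟨k, hk⟩ := hpg (QuotientGroup.mk ⟨q, hq⟩)
    refine ⟨k, ?_⟩
    rw [← QuotientGroup.mk_pow, QuotientGroup.eq_one_iff, Subgroup.mem_subgroupOf] at hk
    exact hk
  have hQ₁ : IsPGroup p (G₁ ⧸ H₁) := by
    intro z
    obtain ⟨⟨x, hx⟩, rfl⟩ := QuotientGroup.mk_surjective z
    have hx' : (x : G) ∈ ((H ⊔ P : Subgroup G) : Set G) := hx
    rw [Subgroup.mul_normal] at hx'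
    obtain ⟨h, hh, q, hq, rfl⟩ := Set.mem_mul.mp hx'
    obtain ⟨k, hk⟩ := hPq q hq
    refine ⟨k, ?_⟩
    have hhG : h ∈ G₁ := hHG₁ hh
    have hqG : q ∈ G₁ := hPG₁ hq
    have hsplit : (⟨h * q, hx⟩ : G₁) = ⟨h, hhG⟩ * ⟨q, hqG⟩ := rfl
    have hh1 : (QuotientGroup.mk (⟨h, hhG⟩ : G₁) : G₁ ⧸ H₁) = 1 :=
      (QuotientGroup.eq_one_iff _).mpr (Subgroup.mem_subgroupOf.mpr hh)
    rw [hsplit, QuotientGroup.mk_mul, hh1, one_mul, ← QuotientGroup.mk_pow, QuotientGroup.eq_one_iff,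
      hH₁, Subgroup.mem_subgroupOf, Subgroup.coe_pow]
    exact hk
  -- the descent inside `G₁`
  have hopen₁ : IsOpen (H₁ : Set G₁) :=
    (isOpen_and_exists_normalGenerators_of_sup_eq_top (G := G₁) hP₁c hP₁el hg₁
      ⟨Set.range y₁, Set.finite_range y₁, by rintro _ ⟨qa, rfl⟩; exact hy₁P qa, ⊤,
        by rw [Subgroup.coe_top]; exact isOpen_univ, by rw [hy₁N]; exact inf_le_right⟩
      ha₁ H₁.index H₁ rfl hsup hQ₁).1
  -- back to `G`
  have himg : (H : Set G) = Subtype.val '' (H₁ : Set G₁) := by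
    ext z
    constructor
    · intro hz
      exact ⟨⟨z, hHG₁ hz⟩, Subgroup.mem_subgroupOf.mpr hz, rfl⟩
    · rintro ⟨w, hw, rfl⟩
      exact Subgroup.mem_subgroupOf.mp hw
  rw [himg]
  exact hG₁o.isOpenMap_subtype_val _ hopen₁

end Literature.GroupTheory
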